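import Literature.NumberTheory.EllipticCurves.HeegnerModuleIndex
import HarnessLib

/-!
# Burungale–Castella–Kim, arXiv:1908.09512v1 (2019), Theorem 3.1: Howard's Heegner-point
# Kolyvagin-system theorem under residual IRREDUCIBILITY (no surjectivity of the `p`-adic
# representation) — a FIRST-VERSION preprint statement, absent from the refereed ANT 15 (2021) text

Topic `NumberTheory/EllipticCurves`; one named fact (a `def … : Prop`, nothing asserted), in the
vocabulary of the tree's `Howard2004_thmB` (`HeegnerModuleIndex.lean`).

A. Burungale, F. Castella, C.-H. Kim, *A proof of Perrin-Riou's Heegner point main conjecture*,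
preprint version **arXiv:1908.09512v1** (26 Aug 2019), **Theorem 3.1 (Howard)** (v1 numbering; the
statement is ABSENT from arXiv v2 = Algebra & Number Theory 15 (2021) 1627–1653 — see the PROVENANCE
FLAG below), verbatim: "Assume that `p > 3` is a good ordinary prime for `E`, `D_K` is coprime to
`pN`, and `ρ̄|_{G_K}` is absolutely irreducible. Then: (i) There exists a Kolyvagin system `κ^∞` for
`(𝐓, 𝓕_ord)` with `κ^∞_1 ≠ 0`. (ii) `Sel_Gr(K, 𝐓)` is a torsion-free, rank one `Λ`-module. (iii) There
is a torsion `Λ`-module `M_∞` such that `Char_Λ(M_∞) = Char_Λ(M_∞)^ι` and a pseudo-isomorphism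
`X ∼ Λ ⊕ M_∞ ⊕ M_∞`. (iv) `Char_Λ(M_∞)` divides `Char_Λ(Sel_Gr(K,𝐓)/Λκ^∞_1)`. Proof. This is due to
Howard [How04a, How04b], where the divisibility in part (iv) is possibly up to powers of the ideal
`pΛ` when `N⁻ ≠ 1`. In the following paragraphs, we explain how to deduce an integral divisibility
from a slight refinement of his arguments (essentially contained in [Fouquet, Compositio 2013])".
Here `K` is an imaginary quadratic field satisfying the (generalised) Heegner hypothesis for
`N = N⁺N⁻`; the classical case `N⁻ = 1` (every prime of `N` splits in `K`) is Howard's setting.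

PROVENANCE FLAG `BCK21v1-3.1-SUPERSEDED@How04+Fouquet13` (VERSION CORRECTION 2026-08-28, literature
seat of cell `bsd-print-x9`, DOSSIER §50.11; supersedes the earlier flag `BCK21-3.1@How04+Fouquet13`
and its label "refereed statement, proof by citation"): the quoted "Theorem 3.1 (Howard)" is the
text of the FIRST arXiv version **arXiv:1908.09512v1 (26 Aug 2019)** — the version held in the
project's literature store as `paper:arxiv-1908.09512` (corpus-tex), §3, chunk p0007 L18–44. It is
**NOT printed in the refereed version**: the revised version arXiv:1908.09512v2 (14 Oct 2020, "Revised
version, to appear in Algebra & Number Theory"; journal milestones: received 28 Aug 2019, revised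
4 Sep 2020, accepted 12 Oct 2020) = Algebra & Number Theory 15 (2021) 1627–1653 reorganised the paper
(§3 "Proof of Theorem A", §5 "Proof of Theorem B", Appendix A) and states Howard's divisibility ONLY
as **Theorem 3.4 (Howard)**: "Assume that the pair `(ρ̄, N⁻)` satisfies Condition CR. Then both `𝐒`
and `X` have `Λ`-rank one, and the following divisibility holds in `Λ`:
`Char_Λ(X_tors) ⊃ Char_Λ(𝐒/Λκ₁)²` (11). Moreover, the divisibility in (11) is an equality if [a
non-vanishing criterion for the bipartite system `λ`]", where **Condition CR** (v2 §3, p. 8) is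
"(i) `ρ̄` is ramified at every prime `ℓ ∣ N⁻` with `ℓ ≡ ±1 (mod p)`, (ii) `ρ̄` is SURJECTIVE"; the
v2/journal text contains no statement of Howard's divisibility under (absolute) irreducibility alone
and no citation of Fouquet 2013 (its main Theorems A/B and Appendix Thm A.1 all assume `ρ̄`
surjective). So the statement below is an UNREFEREED preprint claim (v1, proof "by citation": Howard,
Compositio 140 (2004) Thms A/B — printed under "`G_K → Aut_{ℤ_p}(T)` surjective" — plus "a slight
refinement … essentially contained in [Fouquet, Compositio 2013]"), WITHDRAWN by the authors in
revision. What IS in refereed print at irreducible, non-surjective image: Fouquet, Compositio 149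
(2013), Thm B (ii) with Assumption 5.10 (an INTEGRAL divisibility in Fouquet's own currency
`char H̃²_tors ∣ (char H̃¹/Λ z_{f,∞})²`, under his hypotheses 3.4, 3.5 (`p`-distinguished), 3.10, 5.13)
and Cor. 5.21 (residual scalar ⇒ Sah's lemma ⇒ Howard's H.1/H.2, under `p ∤ 6φ(N)`);
Castella–Grossi–Lee–Skinner, Invent. 227 (2022), Thm 3.4.1 / Cor 3.4.2 and Castella–Grossi–Skinner,
Math. Ann. (2023), Thm 5.5.2 (the divisibility in `Λ[1/p, 1/(γ-1)]` resp. `Λ[1/p]`, no image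
hypothesis); Mastella–Zerman, arXiv:2505.08710 (2025, preprint), Cor. 4.6 (integral, `p ∤ h_K`, scalars
`1 + pℤ_p` in the `p`-adic image — `MastellaZerman2026.cor46_howardDivisibility_of_scalarImage`). The
cell `bsd-smallim` memo `koly/KOLY-MEMO.md` Thm 4.1 (refereed in the cell, REF-KOLY-VERDICT
2026-08-25: PASS) proves the statement below by an explicit audit of the six sites where Howard's text
uses the image hypothesis, with the `p`-adic-image step (Teichmüller lift of the residual scalar;
kernel `Serre1972.exists_mat_eq_smul_one_ne_one`) made explicit — that memo, not the journal, is the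
statement's present provenance. The Lean statement is UNCHANGED by this correction (a `Prop`, nothing
asserted); consumers (`MastellaZerman2026.conclusion_of_thm31`,
`YanZhu2026.….heegnerContainment_of_thm31`, `Rank1Residual.howard2004_thmB_of_irreducible_of_bck21`,
`Rank1Residual.howardThmBConclusion_of_classX9_of_bck21`) keep type-checking; only the label
"PUB, proof by citation" attached to the hypothesis `(h : thm31_howardThmB_of_irreducible)` is wrong.

TRANSCRIPTION (weaker than print, never stronger): we record ONLY Howard's Theorem B clauses
(ii)–(iv) in the exact shape of the tree's `Howard2004_thmB` (rank one + torsion-freeness of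
`𝔖 = lim S_p(E/K_n)`, rank one of `X`, `char(X_{Λ-tors}) ∣ I(ℋ_∞)²`), in the CLASSICAL Heegner case,
with Howard's `d_K ∉ {-3,-4}` and `p ∤ h_K` kept (extra hypotheses only weaken the fact), `p ≥ 5`,
and with "`ρ̄|_{G_K}` absolutely irreducible" replaced by the STRONGER hypothesis "`E[p]` is an
irreducible `𝔽_p[Γ_ℚ]`-module and `p ∤ d_K`" (for `K` with `(d_K, Np) = 1`, `K ∩ ℚ(E[p]) = ℚ`, so
`ρ̄(G_K) = ρ̄(Γ_ℚ)` is odd and irreducible, hence absolutely irreducible — memo Lemma 2.1).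

## References

* [BurungaleCastellaKim2021] arXiv:1908.09512**v1** (2019), Thm. 3.1 — statement of the FIRST
  preprint version only; the refereed version ANT 15 (2021) 1627–1653 = arXiv:1908.09512v2 prints
  instead Thm. 3.4 (Howard) under Condition CR ((ii) `ρ̄` surjective) and Thm. 5.2 (Howard-form ⟺
  Greenberg-form divisibilities under `H⁰(G_K, ρ̄) = 0`).
* [Howard2004HeegnerKolyvagin] B. Howard, Compositio Math. 140 (2004), Thms. A, B.
* [Fouquet2013Dihedral] O. Fouquet, Compositio Math. 149 (2013), Thm. A, Thm. B (ii), Ass. 5.10,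
  Cor. 5.21.
-/

noncomputable section

open scoped Classical

universe u

namespace Literature.NumberTheory.EllipticCurves.BurungaleCastellaKim2021

open WeierstrassCurve Literature.NumberTheory.EllipticCurves

/-- **Burungale–Castella–Kim 2021, Thm. 3.1 (Howard's Theorem B under residual irreducibility),
clauses (ii)–(iv), classical Heegner case**, in the shape of the tree's `Howard2004_thmB` with the
field `surjective` of `HowardHypotheses` replaced by `E[p]` irreducible over `Γ_ℚ` (and `p ≥ 5`):
for `W/ℚ` elliptic, `K` imaginary quadratic with `d_K ∉ {-3,-4}`, every prime of `N` split in `K`,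
`p ∤ N d_K h_K`, `E` good ordinary at `p`, `E[p]` irreducible, `κ` the anticyclotomic
`ℤ_p`-extension with topological generator `γ`, and any `Λ`-adic Selmer datum `D`, Heegner family `F`
and Selmer-dual datum `X`: `𝔖 = D.S` is finitely generated, torsion-free of rank one; `X` is
finitely generated of rank one; and `char_Λ(X_{Λ-tors})` divides `I(ℋ_∞)²`
(`heegnerCharIdeal D F ^ 2`). Printed: "Assume that `p > 3` is a good ordinary prime for `E`, `D_K`
is coprime to `pN`, and `ρ̄|_{G_K}` is absolutely irreducible. Then … (ii) `Sel_Gr(K,𝐓)` is a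
torsion-free, rank one `Λ`-module. (iii) … `X ∼ Λ ⊕ M_∞ ⊕ M_∞`. (iv) `Char_Λ(M_∞)` divides
`Char_Λ(Sel_Gr(K,𝐓)/Λκ^∞_1)`." PRINTED ONLY IN THE FIRST PREPRINT VERSION arXiv:1908.09512v1
(proof there by citation: Howard 2004 under big image + "essentially" Fouquet 2013 for the image
relaxation) and WITHDRAWN in the refereed version arXiv v2 = ANT 15 (2021), which prints Howard's
divisibility only as Thm. 3.4 under Condition CR ((ii) `ρ̄` surjective) — flag
`BCK21v1-3.1-SUPERSEDED@How04+Fouquet13` (module docstring); proved in the cell memo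
`bsd-smallim/koly/KOLY-MEMO.md` Thm 4.1 (REF-KOLY-VERDICT PASS), which is the statement's present
provenance. A `Prop`; nothing asserted; statement unchanged by the 2026-08-28 provenance correction.
[cite: BurungaleCastellaKim2021, arXiv:1908.09512v1 Thm. 3.1 (ii)–(iv) — v1 only, not in ANT 15]
[cite: Howard2004HeegnerKolyvagin, §1 Thm. B] [cite: Fouquet2013Dihedral, Thm. B (ii), Cor. 5.21] -/
def thm31_howardThmB_of_irreducible : Prop :=
  ∀ (N : ℕ) [NeZero N] (W : WeierstrassCurve ℚ) [W.IsElliptic] [W.IsGloballyMinimal]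
    (K : Type u) [Field K] [NumberField K] (p : ℕ) [Fact p.Prime] (κ : ZpExtension K p)
    (γ : Field.absoluteGaloisGroup K) (jbar : AlgebraicClosure K →+* ℂ),
    IsImaginaryQuadratic K → (NumberField.discr K ≠ -3 ∧ NumberField.discr K ≠ -4) →
    SatisfiesHeegnerHypothesis N K → 5 ≤ p → ¬ p ∣ N → ¬ (p : ℤ) ∣ NumberField.discr K →
    ¬ p ∣ NumberField.classNumber K → W.HasIrreducibleModPGaloisRep p → IsOrdinaryAt W p →
    κ.IsAnticyclotomic → κ.IsTopGenerator γ →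
    ∀ (D : (W.baseChange K).LambdaAdicSelmerData κ γ) (F : HeegnerFamily N W K κ jbar)
      (X : (W.baseChange K).SelmerDualData κ γ),
      (Module.Finite (IwasawaAlgebra p) D.S ∧ NoZeroSMulDivisors (IwasawaAlgebra p) D.S ∧
          Module.finrank (IwasawaAlgebra p) D.S = 1) ∧
        (Module.Finite (IwasawaAlgebra p) X.X ∧ Module.finrank (IwasawaAlgebra p) X.X = 1 ∧
          Module.charIdeal (IwasawaAlgebra p) (Submodule.torsion (IwasawaAlgebra p) X.X) ∣
            heegnerCharIdeal D F ^ 2)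

/-- The named fact implies the tree's `Howard2004_thmB` (printed under `p`-adic surjectivity) on
the locus `p ≥ 5`, `E[p]` irreducible — bookkeeping showing the two records share one shape.
[cite: BurungaleCastellaKim2021, arXiv:1908.09512v1 Thm. 3.1 (v1 only)] -/
theorem howard2004_thmB_of_thm31 (h : thm31_howardThmB_of_irreducible.{u})
    (N : ℕ) [NeZero N] (W : WeierstrassCurve ℚ) [W.IsElliptic] [W.IsGloballyMinimal]
    (K : Type u) [Field K] [NumberField K] (p : ℕ) [Fact p.Prime] (κ : ZpExtension K p)
    (γ : Field.absoluteGaloisGroup K) (jbar : AlgebraicClosure K →+* ℂ) (hp : 5 ≤ p)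
    (hirr : W.HasIrreducibleModPGaloisRep p) : Howard2004_thmB N W K p κ γ jbar :=
  fun hyp D F X => h N W K p κ γ jbar hyp.isImaginaryQuadratic hyp.discr_ne hyp.heegner hp
    hyp.not_dvd_level hyp.not_dvd_discr hyp.not_dvd_classNumber hirr hyp.ordinary
    hyp.anticyclotomic hyp.topGenerator D F X

end Literature.NumberTheory.EllipticCurves.BurungaleCastellaKim2021
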